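import Summits.QuantumFields.BalabanUV.Beta.GAN24.MixedSlotCarrier

/-!
# `BalabanUV.Beta.GAN24.MixedStepLinearity` — binder row G-an2-4 ∕ (CONV-C), W-slot, the (α-0) parity re-cut, located crux (Q-L-k₀), the DRIFT rows
# (leaf-03 g68 FILE 4 `HΔw`): **LETTERS FOR THE INTERPOLATION ROUTE — the mixed step is HOMOGENEOUS and ADDITIVE in each of its three kernels, leaf-03's
# source chain is homogeneous in its table, and a diagonal bottom step RE-ROOTS as the natural window of the swapped family.**

NOT IN PRINT; OUR BOOKKEEPING ([folklore] linearity bookkeeping on leaf-03's `Lin4LegTower` ∕ `Lin4LegTowerUnroll` (`legStep`, `bsum`, `legStepB`, `legChain`,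
`bsumPow`) and the OWNER gan24-p1 g37's part 9 `MixedSlotCarrier` (`vertex2OfK₂`, `vsym₂`, `legStep₃`, the `sub` linearity in each kernel, `legChain_update_below`);
0 `def`, 0 cited facts, 0 `def … : Prop`, 0 sorry).  HONEST FRAMING (cell contract, verbatim): «discharging `BetaPertH` makes Bałaban's UV stability UNCONDITIONAL
— a real constructive-QFT result; it is NOT the continuum limit and NOT the Clay problem.»  HONEST DEPENDENCY (verbatim): «continuum YM on T⁴ ⇐ BetaPertH ∧ nine
spine estimates (0/9 proved); BetaPertH ⇐ (D1) ∧ (D4) ∧ CAP+tail; G-an2-4 gates asym, D1 and NE2/3/4.»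

WHAT (generic `d`):
* §1 homogeneity (unconditional, `tsum_mul_left`): `vertex2OfK₂_smul_fst ∕ _snd`, `vsym₂_smul_fst ∕ _snd`, **`legStep₃_smul_fst ∕ _snd ∕ _kernel`**, `legStep_smul_table`,
  `bsumPow_smul`, `legChain_smul`, **`legChain_bsumPow_smul`** (the window map `X ↦ legChain kc K N m k (bsumPow N q ∘ X)` is homogeneous);
* §2 additivity of `legStep₃` in each kernel on bounded tables (part 9's `sub` letters ⨾ §1): **`legStep₃_add_fst ∕ _snd ∕ _kernel`**; `decays_neg_of`, `decays_smul_of`, `decays_add_min'`;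
* §3 re-rooting: **`legChain_succ_bottom`** (bottom unrolling of the source chain, definitional), `bsumPow_bsum`, **`bsumPow_legStep`** (`bsum_legStep` `q` times),
  **`legChain_reroot_bottom`**: `legChain kc (update K (l+1) M) N (l+1) (q+1) (bsumPow N (q+1) ∘ W) = legChain kc K N (l+2) q (bsumPow N q ∘ legStep (kc (l+1)) M M N (𝔹W))`
  — a diagonal bottom step with kernel `M` under the natural `q`-window IS the natural `(q+1)`-window of the family swapped to `M` at level `l+1` (the H1-window shape, whose
  composite legs `kChain (krow ∘ update K (l+1) M) (l+1) q` ∕ `Push4Iter.legChain (colH ∘ update K (l+1) M) (l+1) q` are the OWNER's 8a ∕ 8b objects).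
Consumed by `GAN24/StepDifferenceInterpolation` (the drift window `HΔw` from four such windows).  Asserts NOTHING about Bałaban's tables; NOT (H1Δw); NOTHING of
(Q-L) ∕ (H1♮) ∕ (C)sym discharged; NEVER «G-an2-4 closed» as (CONV-C); NOT D1, NOT `BetaPertH`, NOT continuum, NOT Clay; not in print.
Unit `b2b-balaban-gan24-formalise-leaf-01` (G-an2-4 formalisation swarm, leaf prover 01), gen 75, 2026-08-23.
-/

noncomputable section

open Finset
open scoped BigOperators
open Literature.MathematicalPhysics.QuantumFieldTheory
open Literature.MathematicalPhysics.QuantumFieldTheory.Balaban1983to89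
open Literature.MathematicalPhysics.QuantumFieldTheory.Balaban1983to89.Beta
open B12Sec2to5 (l1 l1_nonneg)
open ExpKernelCalculus (MKer Site Decays comp)
open OneStepResolventKernel (Fib wsum)
open OneStepKernelFamily (colH vertexOfK)
open Summit.QuantumFields.BalabanUV.Beta.GAN24.T2RecursionAffine (vsym)
open Summit.QuantumFields.BalabanUV.Beta.GAN24.Lin4Additive (vsym_smul)
open Summit.QuantumFields.BalabanUV.Beta.GAN24.Lin4LegTower (bsum bsum_smul mreadL legStep bsum_legStep)
open Summit.QuantumFields.BalabanUV.Beta.GAN24.Lin4LegTowerTwo (bdd_bsum)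
open Summit.QuantumFields.BalabanUV.Beta.GAN24.Lin4LegTowerUnroll (legStepB bsumPow legChain bddTab_bsumPow)
open Summit.QuantumFields.BalabanUV.Beta.GAN24.LegSlotDivergenceCommute (mreadL_smul)
open Summit.QuantumFields.BalabanUV.Beta.GAN24.MixedSlotCarrier (vertex2OfK₂ vsym₂ legStep₃ legStep₃_sub_fst legStep₃_sub_snd legStep₃_sub_kernel
  legChain_update_below)
open Summit.QuantumFields.BalabanUV.Beta.GAN24.BiStencilZeroMode (Tab)

namespace Summit.QuantumFields.BalabanUV.Beta.GAN24.MixedStepLinearity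

variable {d : ℕ}

/-! ## §1 Homogeneity letters (unconditional: `tsum_mul_left`) -/

section Smul

variable (c : ℝ) (G G₁ G₂ K : MKer (d + 1) (Fib d)) (N : ℕ)

/-- [folklore] Entry form: the chain-rule vertex is homogeneous in its KERNEL. -/
theorem vertexOfK_smul_kernel_apply (S : Fin (d + 1) → (Fin (d + 1) → ℤ) → MKer (d + 1) (Fib d)) (μ : Fin (d + 1)) (y : Fin (d + 1) → ℤ)
    (x z : Fin (d + 1) → ℤ) (a b : Fib d) : vertexOfK (c • G) N S μ y x z a b = c * vertexOfK G N S μ y x z a b := by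
  simp only [vertexOfK, wsum, colH, Pi.smul_apply, smul_eq_mul]
  rw [Finset.mul_sum]
  refine Finset.sum_congr rfl fun κ' _ => ?_
  rw [← tsum_mul_left]
  exact tsum_congr fun u => by ring

/-- [folklore] Entry form: the chain-rule vertex is homogeneous in its FAMILY. -/
theorem vertexOfK_smul_family_apply (S : Fin (d + 1) → (Fin (d + 1) → ℤ) → MKer (d + 1) (Fib d)) (μ : Fin (d + 1)) (y : Fin (d + 1) → ℤ)
    (x z : Fin (d + 1) → ℤ) (a b : Fib d) : vertexOfK G N (fun κ u => c • S κ u) μ y x z a b = c * vertexOfK G N S μ y x z a b := by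
  simp only [vertexOfK, wsum, Pi.smul_apply, smul_eq_mul]
  rw [Finset.mul_sum]
  refine Finset.sum_congr rfl fun κ' _ => ?_
  rw [← tsum_mul_left]
  exact tsum_congr fun u => by ring

/-- [folklore] The mixed bi-vertex is homogeneous in its FIRST kernel. -/
theorem vertex2OfK₂_smul_fst (T : Tab d) (μ : Fin (d + 1)) (y : Fin (d + 1) → ℤ) (ν : Fin (d + 1)) (y' : Fin (d + 1) → ℤ) :
    vertex2OfK₂ (c • G₁) G₂ N T μ y ν y' = c • vertex2OfK₂ G₁ G₂ N T μ y ν y' := by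
  funext x z a b
  exact vertexOfK_smul_kernel_apply c G₁ N (fun κ u => vertexOfK G₂ N (T κ u) ν y') μ y x z a b

/-- [folklore] The mixed bi-vertex is homogeneous in its SECOND kernel. -/
theorem vertex2OfK₂_smul_snd (T : Tab d) (μ : Fin (d + 1)) (y : Fin (d + 1) → ℤ) (ν : Fin (d + 1)) (y' : Fin (d + 1) → ℤ) :
    vertex2OfK₂ G₁ (c • G₂) N T μ y ν y' = c • vertex2OfK₂ G₁ G₂ N T μ y ν y' := by
  have hin : (fun κ u => vertexOfK (c • G₂) N (T κ u) ν y') = fun κ u => c • vertexOfK G₂ N (T κ u) ν y' := by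
    funext κ u x z a b
    exact vertexOfK_smul_kernel_apply c G₂ N (T κ u) ν y' x z a b
  funext x z a b
  show vertexOfK G₁ N (fun κ u => vertexOfK (c • G₂) N (T κ u) ν y') μ y x z a b = c * vertex2OfK₂ G₁ G₂ N T μ y ν y' x z a b
  rw [hin]
  exact vertexOfK_smul_family_apply c G₁ N (fun κ u => vertexOfK G₂ N (T κ u) ν y') μ y x z a b

/-- [folklore] `vsym₂` is homogeneous in its first kernel. -/
theorem vsym₂_smul_fst (T : Tab d) (μ : Fin (d + 1)) (y : Fin (d + 1) → ℤ) (ν : Fin (d + 1)) (y' : Fin (d + 1) → ℤ) :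
    vsym₂ (c • G₁) G₂ N T μ y ν y' = c • vsym₂ G₁ G₂ N T μ y ν y' := by
  simp only [vsym₂]
  rw [vertex2OfK₂_smul_fst, vertex2OfK₂_smul_fst, ← smul_add, smul_smul, smul_smul, mul_comm]

/-- [folklore] `vsym₂` is homogeneous in its second kernel. -/
theorem vsym₂_smul_snd (T : Tab d) (μ : Fin (d + 1)) (y : Fin (d + 1) → ℤ) (ν : Fin (d + 1)) (y' : Fin (d + 1) → ℤ) :
    vsym₂ G₁ (c • G₂) N T μ y ν y' = c • vsym₂ G₁ G₂ N T μ y ν y' := by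
  simp only [vsym₂]
  rw [vertex2OfK₂_smul_snd, vertex2OfK₂_smul_snd, ← smul_add, smul_smul, smul_smul, mul_comm]

/-- [folklore] **`legStep₃` IS HOMOGENEOUS IN ITS FIRST SLOT KERNEL** (no summability). -/
theorem legStep₃_smul_fst (kc : ℝ) (W : Tab d) (κ : Fin (d + 1)) (u : Fin (d + 1) → ℤ) (κ' : Fin (d + 1)) (u' : Fin (d + 1) → ℤ) :
    legStep₃ kc (c • G₁) G₂ K N W κ u κ' u' = c • legStep₃ kc G₁ G₂ K N W κ u κ' u' := by
  unfold legStep₃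
  rw [vsym₂_smul_fst, KernelReflection.comp_smul_right, mreadL_smul, smul_comm]

/-- [folklore] **`legStep₃` IS HOMOGENEOUS IN ITS SECOND SLOT KERNEL**. -/
theorem legStep₃_smul_snd (kc : ℝ) (W : Tab d) (κ : Fin (d + 1)) (u : Fin (d + 1) → ℤ) (κ' : Fin (d + 1)) (u' : Fin (d + 1) → ℤ) :
    legStep₃ kc G₁ (c • G₂) K N W κ u κ' u' = c • legStep₃ kc G₁ G₂ K N W κ u κ' u' := by
  unfold legStep₃
  rw [vsym₂_smul_snd, KernelReflection.comp_smul_right, mreadL_smul, smul_comm]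

/-- [folklore] **`legStep₃` IS HOMOGENEOUS IN ITS KERNEL LEG**. -/
theorem legStep₃_smul_kernel (kc : ℝ) (W : Tab d) (κ : Fin (d + 1)) (u : Fin (d + 1) → ℤ) (κ' : Fin (d + 1)) (u' : Fin (d + 1) → ℤ) :
    legStep₃ kc G₁ G₂ (c • K) N W κ u κ' u' = c • legStep₃ kc G₁ G₂ K N W κ u κ' u' := by
  unfold legStep₃
  rw [KernelReflection.comp_smul_left, mreadL_smul, smul_comm]

/-- [folklore] leaf-03's one-step leg map is homogeneous in its TABLE (no summability). -/
theorem legStep_smul_table (kc : ℝ) (W : Tab d) (κ : Fin (d + 1)) (u : Fin (d + 1) → ℤ) (κ' : Fin (d + 1)) (u' : Fin (d + 1) → ℤ) :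
    legStep kc G K N (c • W) κ u κ' u' = c • legStep kc G K N W κ u κ' u' := by
  unfold legStep
  rw [vsym_smul, KernelReflection.comp_smul_right, mreadL_smul, smul_comm]

end Smul

/-- [folklore] The `q`-fold block sum is homogeneous. -/
theorem bsumPow_smul (N : ℕ) (c : ℝ) : ∀ (q : ℕ) (F : MKer (d + 1) (Fib d)), bsumPow N q (c • F) = c • bsumPow N q F
  | 0, _ => rfl
  | q + 1, F => by
    show bsum N (bsumPow N q (c • F)) = c • bsum N (bsumPow N q F)
    rw [bsumPow_smul N c q F, bsum_smul]

/-- [folklore] leaf-03's source chain is homogeneous in its table (unconditional). -/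
theorem legChain_smul (kc : ℕ → ℝ) (Kf : ℕ → MKer (d + 1) (Fib d)) (N m : ℕ) (c : ℝ) :
    ∀ (k : ℕ) (X : Tab d), legChain kc Kf N m k (c • X) = c • legChain kc Kf N m k X
  | 0, _ => rfl
  | k + 1, X => by
    funext κ u κ' u'
    show legStep (kc (m + k)) (Kf (m + k)) (Kf (m + k)) N (legChain kc Kf N m k (c • X)) κ u κ' u'
      = c • legStep (kc (m + k)) (Kf (m + k)) (Kf (m + k)) N (legChain kc Kf N m k X) κ u κ' u'
    rw [legChain_smul kc Kf N m c k X, legStep_smul_table]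

/-- [folklore] **THE WINDOW MAP `X ↦ legChain kc K N m k (bsumPow N q ∘ X)` IS HOMOGENEOUS** (unconditional). -/
theorem legChain_bsumPow_smul (kc : ℕ → ℝ) (Kf : ℕ → MKer (d + 1) (Fib d)) (N m k q : ℕ) (c : ℝ) (X : Tab d) :
    legChain kc Kf N m k (fun κ u κ' u' => bsumPow N q ((c • X) κ u κ' u')) = c • legChain kc Kf N m k (fun κ u κ' u' => bsumPow N q (X κ u κ' u')) := by
  have e : (fun κ u κ' u' => bsumPow N q ((c • X) κ u κ' u')) = c • fun κ u κ' u' => bsumPow N q (X κ u κ' u') := by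
    funext κ u κ' u'
    exact bsumPow_smul N c q (X κ u κ' u')
  rw [e, legChain_smul]

/-! ## §2 Additivity of the mixed step in each kernel (part 9's `sub` letters ⨾ §1) -/

section Add

variable {G G' G₁ G₂ K K' : MKer (d + 1) (Fib d)} {C δ C' δ' C₁ δ₁ C₂ δ₂ CK δK CK' δK' B : ℝ} {N : ℕ}

/-- [folklore] `Decays` is stable under negation. -/
theorem decays_neg_of (hG : Decays G C δ) : Decays (-G) C δ := fun x y a b => by
  rw [Pi.neg_apply, Pi.neg_apply, Pi.neg_apply, Pi.neg_apply, abs_neg]; exact hG x y a b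

/-- [folklore] `Decays` under a scalar: constant `|c|·C`. -/
theorem decays_smul_of (c : ℝ) (hG : Decays G C δ) : Decays (c • G) (|c| * C) δ := fun x y a b => by
  rw [Pi.smul_apply, Pi.smul_apply, Pi.smul_apply, Pi.smul_apply, smul_eq_mul, abs_mul, mul_assoc]
  exact mul_le_mul_of_nonneg_left (hG x y a b) (abs_nonneg c)

/-- [folklore] The sum of two decaying kernels decays (sum of the constants, the smaller rate). -/
theorem decays_add_min' (hG : Decays G C δ) (hG' : Decays G' C' δ') (hC : 0 ≤ C) (hC' : 0 ≤ C') :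
    Decays (G + G') (C + C') (min δ δ') := fun x y a b => by
  have hl := l1_nonneg (x - y)
  have e1 : Real.exp (-δ * l1 (x - y)) ≤ Real.exp (-(min δ δ') * l1 (x - y)) := Real.exp_le_exp.2 (by nlinarith [min_le_left δ δ'])
  have e2 : Real.exp (-δ' * l1 (x - y)) ≤ Real.exp (-(min δ δ') * l1 (x - y)) := Real.exp_le_exp.2 (by nlinarith [min_le_right δ δ'])
  rw [Pi.add_apply, Pi.add_apply, Pi.add_apply, Pi.add_apply]
  calc |G x y a b + G' x y a b| ≤ |G x y a b| + |G' x y a b| := abs_add_le _ _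
    _ ≤ C * Real.exp (-(min δ δ') * l1 (x - y)) + C' * Real.exp (-(min δ δ') * l1 (x - y)) :=
        add_le_add ((hG x y a b).trans (mul_le_mul_of_nonneg_left e1 hC)) ((hG' x y a b).trans (mul_le_mul_of_nonneg_left e2 hC'))
    _ = (C + C') * Real.exp (-(min δ δ') * l1 (x - y)) := by ring

/-- [folklore] **`legStep₃` IS ADDITIVE IN ITS FIRST SLOT KERNEL** (bounded table; all kernels decaying). -/
theorem legStep₃_add_fst (hG : Decays G C δ) (hδ : 0 < δ) (hG' : Decays G' C' δ') (hδ' : 0 < δ') (hG₂ : Decays G₂ C₂ δ₂) (hδ₂ : 0 < δ₂)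
    (hK : Decays K CK δK) (hδK : 0 < δK) (kc : ℝ) {W : Tab d} (hW : ∀ κ u κ' u' x z a b, |W κ u κ' u' x z a b| ≤ B)
    (κ : Fin (d + 1)) (u : Fin (d + 1) → ℤ) (κ' : Fin (d + 1)) (u' : Fin (d + 1) → ℤ) :
    legStep₃ kc (G + G') G₂ K N W κ u κ' u' = legStep₃ kc G G₂ K N W κ u κ' u' + legStep₃ kc G' G₂ K N W κ u κ' u' := by
  rw [← sub_neg_eq_add G G', legStep₃_sub_fst (N := N) hG hδ (decays_neg_of hG') hδ' hG₂ hδ₂ hK hδK kc hW,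
    show -G' = (-1 : ℝ) • G' from (neg_one_smul ℝ G').symm, legStep₃_smul_fst, neg_one_smul, sub_neg_eq_add]

/-- [folklore] **`legStep₃` IS ADDITIVE IN ITS SECOND SLOT KERNEL**. -/
theorem legStep₃_add_snd (hG₁ : Decays G₁ C₁ δ₁) (hδ₁ : 0 < δ₁) (hC₁ : 0 ≤ C₁) (hG : Decays G C δ) (hδ : 0 < δ) (hG' : Decays G' C' δ') (hδ' : 0 < δ')
    (hK : Decays K CK δK) (hδK : 0 < δK) (kc : ℝ) {W : Tab d} (hW : ∀ κ u κ' u' x z a b, |W κ u κ' u' x z a b| ≤ B)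
    (κ : Fin (d + 1)) (u : Fin (d + 1) → ℤ) (κ' : Fin (d + 1)) (u' : Fin (d + 1) → ℤ) :
    legStep₃ kc G₁ (G + G') K N W κ u κ' u' = legStep₃ kc G₁ G K N W κ u κ' u' + legStep₃ kc G₁ G' K N W κ u κ' u' := by
  rw [← sub_neg_eq_add G G', legStep₃_sub_snd (N := N) hG₁ hδ₁ hC₁ hG hδ (decays_neg_of hG') hδ' hK hδK kc hW,
    show -G' = (-1 : ℝ) • G' from (neg_one_smul ℝ G').symm, legStep₃_smul_snd, neg_one_smul, sub_neg_eq_add]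

/-- [folklore] **`legStep₃` IS ADDITIVE IN ITS KERNEL LEG**. -/
theorem legStep₃_add_kernel (hG₁ : Decays G₁ C₁ δ₁) (hδ₁ : 0 < δ₁) (hG₂ : Decays G₂ C₂ δ₂) (hδ₂ : 0 < δ₂)
    (hK : Decays K CK δK) (hδK : 0 < δK) (hK' : Decays K' CK' δK') (hδK' : 0 < δK') (kc : ℝ) {W : Tab d}
    (hW : ∀ κ u κ' u' x z a b, |W κ u κ' u' x z a b| ≤ B)
    (κ : Fin (d + 1)) (u : Fin (d + 1) → ℤ) (κ' : Fin (d + 1)) (u' : Fin (d + 1) → ℤ) :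
    legStep₃ kc G₁ G₂ (K + K') N W κ u κ' u' = legStep₃ kc G₁ G₂ K N W κ u κ' u' + legStep₃ kc G₁ G₂ K' N W κ u κ' u' := by
  rw [← sub_neg_eq_add K K', legStep₃_sub_kernel (N := N) hG₁ hδ₁ hG₂ hδ₂ hK hδK (decays_neg_of hK') hδK' kc hW,
    show -K' = (-1 : ℝ) • K' from (neg_one_smul ℝ K').symm, legStep₃_smul_kernel, neg_one_smul, sub_neg_eq_add]

end Add

/-! ## §3 Re-rooting: a diagonal bottom step is the natural window of the swapped family -/

section Reroot

variable {kc : ℕ → ℝ} {K : ℕ → MKer (d + 1) (Fib d)} {N : ℕ}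

/-- [folklore] **BOTTOM UNROLLING OF leaf-03's SOURCE CHAIN** (definitional): `legChain kc K N m (k+1) X = legChain kc K N (m+1) k (𝓛_m X)`. -/
theorem legChain_succ_bottom (m : ℕ) : ∀ (k : ℕ) (X : Tab d),
    legChain kc K N m (k + 1) X = legChain kc K N (m + 1) k (fun κ u κ' u' => legStep (kc m) (K m) (K m) N X κ u κ' u')
  | 0, _ => rfl
  | k + 1, X => by
    have ih := legChain_succ_bottom m k X
    have e : m + 1 + k = m + k + 1 := Nat.add_right_comm m 1 k
    funext κ u κ' u'
    show legStep (kc (m + k + 1)) (K (m + k + 1)) (K (m + k + 1)) N (legChain kc K N m (k + 1) X) κ u κ' u'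
      = legStep (kc (m + 1 + k)) (K (m + 1 + k)) (K (m + 1 + k)) N
          (legChain kc K N (m + 1) k (fun κ u κ' u' => legStep (kc m) (K m) (K m) N X κ u κ' u')) κ u κ' u'
    rw [ih, e]

/-- [folklore] `bsumPow N q ∘ bsum N = bsumPow N (q+1)` (definitional bookkeeping). -/
theorem bsumPow_bsum (N : ℕ) : ∀ (q : ℕ) (F : MKer (d + 1) (Fib d)), bsumPow N q (bsum N F) = bsumPow N (q + 1) F
  | 0, _ => rfl
  | q + 1, F => by
    show bsum N (bsumPow N q (bsum N F)) = bsum N (bsumPow N (q + 1) F)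
    rw [bsumPow_bsum N q F]

variable {G Kk : MKer (d + 1) (Fib d)} {CG δG CK δK : ℝ}

/-- [folklore] The `q`-fold block sum of the position index commutes with the one-step leg map (leaf-03's `bsum_legStep`, `q` times; bounded table). -/
theorem bsumPow_legStep (hG : Decays G CG δG) (hδG : 0 < δG) (hK : Decays Kk CK δK) (hδK : 0 < δK) (c : ℝ) :
    ∀ (q : ℕ) {W : Tab d}, (∃ B : ℝ, ∀ κ u κ' u' x z a b, |W κ u κ' u' x z a b| ≤ B) →
      ∀ (κ : Fin (d + 1)) (u : Fin (d + 1) → ℤ) (κ' : Fin (d + 1)) (u' : Fin (d + 1) → ℤ),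
        bsumPow N q (legStep c G Kk N W κ u κ' u') = legStep c G Kk N (fun κ u κ' u' => bsumPow N q (W κ u κ' u')) κ u κ' u'
  | 0, _, _, _, _, _, _ => rfl
  | q + 1, W, hW, κ, u, κ', u' => by
    obtain ⟨B, hB⟩ := bddTab_bsumPow (N := N) hW q
    show bsum N (bsumPow N q (legStep c G Kk N W κ u κ' u')) = legStep c G Kk N (fun κ u κ' u' => bsum N (bsumPow N q (W κ u κ' u'))) κ u κ' u'
    rw [bsumPow_legStep hG hδG hK hδK c q hW κ u κ' u', bsum_legStep hG hδG hK hδK c N hB κ u κ' u']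

/-- NOT IN PRINT; OUR BOOKKEEPING.  **RE-ROOTING**: for a decaying `M` and a bounded `W`, the natural `(q+1)`-window of the family swapped to `M` at level `l+1`
IS the diagonal bottom step with kernel `M` under the natural `q`-window from level `l+2`:
`legChain kc (update K (l+1) M) N (l+1) (q+1) (bsumPow N (q+1) ∘ W) = legChain kc K N (l+2) q (bsumPow N q ∘ legStep (kc (l+1)) M M N (𝔹W))`
(bottom unrolling ⨾ `Function.update_self` ⨾ part 9's `legChain_update_below` ⨾ `bsumPow_legStep` ⨾ `bsumPow_bsum`). -/
theorem legChain_reroot_bottom {M : MKer (d + 1) (Fib d)} {CM δM : ℝ} (hM : Decays M CM δM) (hδM : 0 < δM) (l q : ℕ)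
    {W : Tab d} (hW : ∃ B : ℝ, ∀ κ u κ' u' x z a b, |W κ u κ' u' x z a b| ≤ B) :
    legChain kc (Function.update K (l + 1) M) N (l + 1) (q + 1) (fun κ u κ' u' => bsumPow N (q + 1) (W κ u κ' u'))
      = legChain kc K N (l + 2) q (fun κ u κ' u' => bsumPow N q
          (legStep (kc (l + 1)) M M N (fun κ u κ' u' => bsum N (W κ u κ' u')) κ u κ' u')) := by
  have hBW : ∃ B : ℝ, ∀ κ u κ' u' x z a b, |(fun κ u κ' u' => bsum N (W κ u κ' u')) κ u κ' u' x z a b| ≤ B := by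
    obtain ⟨B, hB⟩ := hW
    exact ⟨_, fun κ u κ' u' x z a b => bdd_bsum N (fun x z a b => hB κ u κ' u' x z a b) x z a b⟩
  rw [legChain_succ_bottom]
  show legChain kc (Function.update K (l + 1) M) N (l + 2) q
      (fun κ u κ' u' => legStep (kc (l + 1)) (Function.update K (l + 1) M (l + 1)) (Function.update K (l + 1) M (l + 1)) N
        (fun κ u κ' u' => bsumPow N (q + 1) (W κ u κ' u')) κ u κ' u') = _
  rw [Function.update_self, legChain_update_below]
  congr 1
  funext κ u κ' u'
  rw [bsumPow_legStep hM hδM hM hδM (kc (l + 1)) q hBW κ u κ' u']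
  simp only [bsumPow_bsum]

end Reroot

end Summit.QuantumFields.BalabanUV.Beta.GAN24.MixedStepLinearity

end
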